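import Summits.Ventures.Crystal3D.Theorems.StickyWulffConstantCoaxialWallLawInPlaneRunEnds
import HarnessLib

/-!
# Plate launch and plate blocking for the LEVEL LEDGER of the terrace census (cf-p1 (ccxli) (I2), items O3a/O3b)

HONEST FRAMING. Venture `Summits/Ventures/Crystal3D` (cell `crystal3d-full`), `route-Ventures-StickyWulffConstant`.  Helper
`--supports` the crux `CoaxialWallLaw` (stmt-Ventures-19481, lane F: these are the two places where PLATES enter lane F's row
mechanism), written for the lattice-free LEVEL LEDGER of lane T's terrace census (stmt-Ventures-23912, line `TexShadow`,
registered stub `stub_terraceCensus`; 19480-p1 g18 '…TexShadowLevelLedgerDefs' p732417: `IsLaunchSet`, `chainTopEnds`,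
`card_le_card_chainTopEnds`).  Rung credit only; F-C1 not moved.

19480-p1's ledger counts c-CHAINS of `X` (maximal strings `b, b + c, b + 2c, …` of balls; no lattice predicate) launched from a
LAUNCH SET (`S ⊆ X`, `b + c ∈ X` for `b ∈ S`, no two balls of `S` on one c-line) and BLOCKED above a height (`e + c ∉ X`).  The
two inputs it asked from lane F (INBOX 2026-08-29T16:26Z, O3a/O3b), for the level `k = 1` (plate-anchored) and a non-descending
slot class `c = A₁ u` of plate 1:
* **`exists_plate_launchSet`** (O3a) — in the complete bottom plate `P₁ = Λ₁ ∩ {−2R₀ ≤ p₂ ≤ −R₀, p₀² + p₁² ≤ ρ²}` (`R₀ ≥ 4`) there is a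
  launch set `S ⊆ P₁` (successors `b + c ∈ P₁`, one ball per c-line: the c-tops of the inner sample
  `Λ₁ ∩ {−2R₀+1 ≤ p₂ ≤ −R₀−2, lateral ≤ (ρ−2)²}`, `runConvex_clampedSample`) with
  `#S ≥ √2·|⟪c, e₃⟫|·π(ρ−2)² − 10√2·π(ρ−2)` (`tops_ge_lineCount`);
* **`plate_blocks_of_not_slot`** (O3b, TRUE FORM — with the lateral guard that sealing needs) — if `c` is NOT a slot vector of plate 2's
  lattice (`c ≠ A₂ w` for all `w ∈ fccSlots`), then no ball `e ∈ X` with `e₂ ≥ h + R₀ + 1` and `e`, `e + c` laterally inside `(ρ−1)²`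
  has `e + c ∈ X` (both would be plate balls by `sealing_above`, and their difference a unit vector of `Λ₂`);
* `not_mem_of_sealed_off_lattice` (O3b for classes that ARE slots of plate 2 but run on an off-lattice line, the co-axial twin
  case): a ball of `X` in the sealed region is a plate ball, so an off-`Λ₂` chain never enters it.
Chains drifting into the lateral rim shell `(ρ−1)² < p₀² + p₁²` are not blocked by the plate; their tops are paid for by the rim
bound `card_rim_window_le` (≤ `6(b − a + 2)(6ρ − 3)` balls in a shell slice), exactly as in `card_inPlane_runEnds_ge_tops`.
WHAT THIS IS NOT: no ledger inequality is assembled here (that is 19480-p1's `card_le_card_chainTopEnds` + (I3)/(I6)); F-C1 not moved.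
-/

noncomputable section

namespace Summit.Ventures.Crystal3D.Theorems

open Summit.Ventures.Crystal3D Finset
open Literature.MathematicalPhysics.StatisticalMechanics (fccStacking)
open scoped InnerProductSpace

open scoped Classical in
/-- **(O3a) PLATE LAUNCH SET.**  See the module docstring. -/
theorem exists_plate_launchSet
    (A₁ : EuclideanSpace ℝ (Fin 3) ≃ₗᵢ[ℝ] EuclideanSpace ℝ (Fin 3)) (t₁ : EuclideanSpace ℝ (Fin 3))
    (P₁ : Finset (EuclideanSpace ℝ (Fin 3))) (R₀ ρ : ℝ) (hR₀ : 4 ≤ R₀) (hρ : R₀ ≤ ρ)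
    (hP₁ : ∀ p, p ∈ P₁ ↔ (p ∈ (fun q => A₁ q + t₁) '' fccStacking 1 (Real.sqrt (2 / 3)) ∧
      -(2 * R₀) ≤ p 2 ∧ p 2 ≤ -R₀ ∧ p 0 ^ 2 + p 1 ^ 2 ≤ ρ ^ 2))
    {u : EuclideanSpace ℝ (Fin 3)} (hu : u ∈ fccSlots)
    (hup : 0 ≤ ⟪A₁ u, EuclideanSpace.single (2 : Fin 3) (1 : ℝ)⟫_ℝ) :
    ∃ S : Finset (EuclideanSpace ℝ (Fin 3)), S ⊆ P₁ ∧ (∀ b ∈ S, b + A₁ u ∈ P₁) ∧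
      (∀ b ∈ S, ∀ b' ∈ S, ∀ k : ℤ, b' = b + (k : ℝ) • A₁ u → b' = b) ∧
      Real.sqrt 2 * |⟪A₁ u, EuclideanSpace.single (2 : Fin 3) (1 : ℝ)⟫_ℝ| * Real.pi * (ρ - 2) ^ 2 -
          10 * Real.sqrt 2 * Real.pi * (ρ - 2) ≤ (S.card : ℝ) := by
  set e₃ : EuclideanSpace ℝ (Fin 3) := EuclideanSpace.single (2 : Fin 3) (1 : ℝ) with he₃
  set Λ₁ := (fun q => A₁ q + t₁) '' fccStacking 1 (Real.sqrt (2 / 3)) with hΛ₁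
  set d : EuclideanSpace ℝ (Fin 3) := A₁ u with hd
  have huΛ : u ∈ fccStacking 1 (Real.sqrt (2 / 3)) := mem_fcc_of_mem_fccSlots hu
  have hd1 : ‖d‖ = 1 := by rw [hd, LinearIsometryEquiv.norm_map, norm_eq_one_of_mem_fccSlots hu]
  have hd2 : d 2 = ⟪A₁ u, e₃⟫_ℝ := apply_two_eq_inner_e₃ _
  have hd2le : d 2 ≤ 1 := by
    have := abs_inner_slot_le_one A₁ hu
    rw [hd2]; exact (le_abs_self _).trans this
  have hd2nn : 0 ≤ d 2 := by rw [hd2]; exact hup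
  -- the inner sample and its tops
  obtain ⟨P'', hP''def⟩ : ∃ P'' : Finset (EuclideanSpace ℝ (Fin 3)), P'' = P₁.filter (fun p =>
      -(2 * R₀) + 1 ≤ p 2 ∧ p 2 ≤ -R₀ - 2 ∧ p 0 ^ 2 + p 1 ^ 2 ≤ (ρ - 2) ^ 2) := ⟨_, rfl⟩
  have hP'' : ∀ p, p ∈ P'' ↔ (p ∈ Λ₁ ∧ -(2 * R₀) + 1 ≤ p 2 ∧ p 2 ≤ -R₀ - 2 ∧ p 0 ^ 2 + p 1 ^ 2 ≤ (ρ - 2) ^ 2) := by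
    intro p
    rw [hP''def, mem_filter, hP₁]
    constructor
    · rintro ⟨⟨hΛ, -, -, -⟩, h1, h2, h3⟩
      exact ⟨hΛ, h1, h2, h3⟩
    · rintro ⟨hΛ, h1, h2, h3⟩
      have hρ0 : (0 : ℝ) ≤ ρ - 2 := by linarith
      exact ⟨⟨hΛ, by linarith, by linarith, by nlinarith⟩, h1, h2, h3⟩
  have hP''P₁ : P'' ⊆ P₁ := by rw [hP''def]; exact filter_subset _ _
  have hconv := runConvex_clampedSample A₁ t₁ (-(2 * R₀) + 1) (-R₀ - 2) (ρ - 2) (by linarith) P'' hP'' huΛ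
  set S := P''.filter fun p => p + d ∉ P'' with hS
  refine ⟨S, (filter_subset _ _).trans hP''P₁, ?_, ?_, ?_⟩
  · -- successors stay in the plate
    intro b hb
    obtain ⟨hbΛ, hb1, hb2, hblat⟩ := (hP'' b).1 (mem_filter.1 hb).1
    have h2' : (b + d) 2 = b 2 + d 2 := by simp
    have hlat : (b + d) 0 ^ 2 + (b + d) 1 ^ 2 ≤ ρ ^ 2 := by
      have h1 := lateral_sq_le_of_dist_le_one (y := b + d) (q := b) (r := ρ - 2) (by linarith) hblat
        (by rw [dist_eq_norm, add_sub_cancel_left, hd1])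
      have : (ρ - 2 + 1) ^ 2 ≤ ρ ^ 2 := by nlinarith
      exact h1.trans this
    exact (hP₁ _).2 ⟨movedFcc_add_site_mem A₁ t₁ hbΛ huΛ, by rw [h2']; linarith, by rw [h2']; linarith, hlat⟩
  · -- one ball per line
    intro b hb b' hb' k hk
    obtain ⟨hbP, hbtop⟩ := mem_filter.1 hb
    obtain ⟨hb'P, hb'top⟩ := mem_filter.1 hb'
    rcases lt_trichotomy k 0 with hneg | hzero | hpos
    · -- `b = b' + (-k) • d` with `-k ≥ 1`: convexity from `b'` puts `b' + d ∈ P''`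
      exfalso
      obtain ⟨n, hn⟩ := Int.eq_ofNat_of_zero_le (show 0 ≤ -k by omega)
      have hn1 : 1 ≤ n := by omega
      have hb_eq : b = b' + ((n : ℕ) : ℝ) • d := by
        rw [hk, add_assoc, ← add_smul]
        have : ((k : ℝ) + ((n : ℕ) : ℝ)) = 0 := by
          have : (k : ℝ) = -((n : ℕ) : ℝ) := by rw [← Int.cast_natCast, ← hn]; push_cast; ring
          rw [this]; ring
        rw [this, zero_smul, add_zero]
      have := hconv b' hb'P n (by rw [← hb_eq]; exact hbP) 1 hn1
      simp only [Nat.cast_one, one_smul] at this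
      exact hb'top this
    · rw [hk, hzero]; simp
    · exfalso
      obtain ⟨n, hn⟩ := Int.eq_ofNat_of_zero_le hpos.le
      have hn1 : 1 ≤ n := by omega
      have hb'_eq : b' = b + ((n : ℕ) : ℝ) • d := by rw [hk, hn]; push_cast; rfl
      have := hconv b hbP n (by rw [← hb'_eq]; exact hb'P) 1 hn1
      simp only [Nat.cast_one, one_smul] at this
      exact hbtop this
  · -- the line count of the inner sample
    have hP''w : ∀ p, p ∈ P'' ↔ (p ∈ Λ₁ ∧ (-(2 * R₀) + 1) ≤ p 2 ∧ p 2 ≤ (-(2 * R₀) + 1) + (R₀ - 3) ∧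
        p 0 ^ 2 + p 1 ^ 2 ≤ (ρ - 2) ^ 2) := by
      intro p; rw [hP'' p, show -(2 * R₀) + 1 + (R₀ - 3) = -R₀ - 2 by ring]
    obtain ⟨Ea, Eb, hEa, hEb, hdet, hframe, -⟩ := exists_frame_of_mem_fccSlots hu
    exact tops_ge_lineCount A₁ t₁ (-(2 * R₀) + 1) (R₀ - 3) (ρ - 2) (by linarith) (by linarith) P'' hP''w
      Ea Eb u hEa hEb (norm_eq_one_of_mem_fccSlots hu) hdet hframe

/-- **(O3b′) THE SEALED REGION IS PLATE.**  A ball of `X` at height `≥ h + R₀ + 1`, laterally inside `(ρ−1)²`, is a ball of the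
complete top plate `P₂` (hence on its lattice): an off-lattice chain never enters the sealed region. -/
theorem mem_plate_of_sealed
    (A₂ : EuclideanSpace ℝ (Fin 3) ≃ₗᵢ[ℝ] EuclideanSpace ℝ (Fin 3)) (t₂ : EuclideanSpace ℝ (Fin 3))
    (X P₂ : Finset (EuclideanSpace ℝ (Fin 3))) (R₀ h ρ : ℝ) (hρ : 1 ≤ ρ)
    (hX : ∀ p ∈ X, ∀ q ∈ X, p ≠ q → 1 ≤ dist p q)
    (hcell : ∀ p ∈ X, -(2 * R₀) ≤ p 2 ∧ p 2 ≤ h + 2 * R₀ ∧ p 0 ^ 2 + p 1 ^ 2 ≤ ρ ^ 2) (hP₂X : P₂ ⊆ X)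
    (hP₂ : ∀ p, p ∈ P₂ ↔ (p ∈ (fun q => A₂ q + t₂) '' fccStacking 1 (Real.sqrt (2 / 3)) ∧
      h + R₀ ≤ p 2 ∧ p 2 ≤ h + 2 * R₀ ∧ p 0 ^ 2 + p 1 ^ 2 ≤ ρ ^ 2))
    {e : EuclideanSpace ℝ (Fin 3)} (he : e ∈ X) (hez : h + R₀ + 1 ≤ e 2) (helat : e 0 ^ 2 + e 1 ^ 2 ≤ (ρ - 1) ^ 2) :
    e ∈ P₂ := by
  by_contra heP
  exact sealing_above A₂ t₂ (h + R₀) (h + 2 * R₀) ρ hρ X P₂ hX hP₂X hP₂ e he heP (by linarith) (hcell e he).2.1 helat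

/-- **(O3b) PLATE BLOCKING for a class that is not a slot of plate 2.**  See the module docstring. -/
theorem plate_blocks_of_not_slot
    (A₂ : EuclideanSpace ℝ (Fin 3) ≃ₗᵢ[ℝ] EuclideanSpace ℝ (Fin 3)) (t₂ : EuclideanSpace ℝ (Fin 3))
    (X P₂ : Finset (EuclideanSpace ℝ (Fin 3))) (R₀ h ρ : ℝ) (hρ : 1 ≤ ρ)
    (hX : ∀ p ∈ X, ∀ q ∈ X, p ≠ q → 1 ≤ dist p q)
    (hcell : ∀ p ∈ X, -(2 * R₀) ≤ p 2 ∧ p 2 ≤ h + 2 * R₀ ∧ p 0 ^ 2 + p 1 ^ 2 ≤ ρ ^ 2) (hP₂X : P₂ ⊆ X)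
    (hP₂ : ∀ p, p ∈ P₂ ↔ (p ∈ (fun q => A₂ q + t₂) '' fccStacking 1 (Real.sqrt (2 / 3)) ∧
      h + R₀ ≤ p 2 ∧ p 2 ≤ h + 2 * R₀ ∧ p 0 ^ 2 + p 1 ^ 2 ≤ ρ ^ 2))
    {c : EuclideanSpace ℝ (Fin 3)} (hc1 : ‖c‖ = 1) (hc2 : 0 ≤ c 2) (hc : ∀ w ∈ fccSlots, c ≠ A₂ w)
    {e : EuclideanSpace ℝ (Fin 3)} (he : e ∈ X) (hez : h + R₀ + 1 ≤ e 2) (helat : e 0 ^ 2 + e 1 ^ 2 ≤ (ρ - 1) ^ 2)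
    (heclat : (e + c) 0 ^ 2 + (e + c) 1 ^ 2 ≤ (ρ - 1) ^ 2) : e + c ∉ X := by
  intro hec
  have heP := mem_plate_of_sealed A₂ t₂ X P₂ R₀ h ρ hρ hX hcell hP₂X hP₂ he hez helat
  have h2' : (e + c) 2 = e 2 + c 2 := by simp
  have hecP := mem_plate_of_sealed A₂ t₂ X P₂ R₀ h ρ hρ hX hcell hP₂X hP₂ hec (by rw [h2']; linarith) heclat
  obtain ⟨p, hp, hpe⟩ := ((hP₂ e).1 heP).1
  obtain ⟨q, hq, hqe⟩ := ((hP₂ (e + c)).1 hecP).1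
  have hpe' : A₂ p + t₂ = e := hpe
  have hqe' : A₂ q + t₂ = e + c := hqe
  have hcq : c = A₂ (q - p) := by
    have h1 : A₂ q + t₂ - (A₂ p + t₂) = c := by rw [hqe', hpe', add_sub_cancel_left]
    rw [← h1, map_sub]; abel
  have hqp : q - p ∈ fccStacking 1 (Real.sqrt (2 / 3)) := fcc_sub_site_mem hq hp
  have hn : ‖q - p‖ = 1 := by rw [← LinearIsometryEquiv.norm_map A₂, ← hcq, hc1]
  exact hc (q - p) (mem_fccSlots_of_unit hqp hn) hcq

end Summit.Ventures.Crystal3D.Theorems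

end
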